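import Summits.QuantumFields.YangMills.Theorems.BalabanUVNodesN16PinnedLayer13CoPHAx
import Summits.QuantumFields.YangMills.Theorems.BalabanUVNodesN16PinnedDataSmallField
import Summits.QuantumFields.BalabanUV.T4Continuum.Support.MinimalActionRefine

/-!
# Route «BalabanUVNodes», crux K3ᴬ `SpineGivenEndpointR13SepCoPHVAx` (stmt-QuantumFields-27247), node N16 = NE3 — out-edges N16 → N19′ ∕ N21 AT THE CENTRE-MAP-GENERIC ∕ Ax
# RATE READING: the loose pin's PER-TUPLE LETTER FACES and node N19's SIDE LETTER `R.ne3.dom ⊆ sfClass 4 R.ne3.L R.ne3.Nper ε₁ 0` at `R := rateCarriersOfRecord₁₃CoPHCmap 𝔯 …` —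
# module 44 `…N16PinnedDataSmallField` §2∕§3 (CoPH reading) re-issued over T1-core's `RateReading₁₃CoPHCmap N Χ` with R12's named pin `N16PinnedLooseCmap`

Cell `pub-ymgap`, seat `pub-ymgap-dag-n16-e` (R134 acceleration seat (a), strategy s2 = BY-NAME KNIT at the record; HUMAN RULING D-0062; chair R424 venue), generation 31,
module 66 (THEOREMS ONLY, 0 `def`, 0 `sorry`, standard axioms; Theses-free; v1.1 = v1 + §4 node N19's row readers `n19_domLetter_of_pinnedLooseCmap_match`,
`radiiRows_rateCarriersCmap_of_pinnedLoose`, `n16LetterBlock_rateCarriersCmap_of_pinnedLoose`, append-only).  `--kind proof --supports stmt-QuantumFields-27247 --as helper` (count-neutral; proves NO registered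
stub).  `bears_on: R4∕N16 · out-edges N16 → N19′ ∕ N21 (stub 2 of K3ᴬ v8)`.  Over R12 `…N16PinnedLayer13CoPHAx` (✓p805490: `N16PinnedLooseCmap`, `rateCarriersCmap_ne3_of_pinnedLoose`,
`eraseNE3Cmap`) and module 44 `…N16PinnedDataSmallField` (its object-level lemmas `sfClass_zero_mono`, `looseDom_nonempty` BY NAME).

WHY.  The K3ᴬ v8 skeleton (`K3Skeleton13SepCoPHAxV8` b38fad1764a2d455) pins node N16's layer by `N16PinnedLooseAx 𝔯 ℓ₃ B` at the Ax tower; its v5-lineage header routes node N19's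
datum radius through «`ε₁ := (ℓ₃ F).ε ∕ B F ≤ R.ne3.b` by module 44 `dom_subset_sfClass_of_pinnedLoose`» — a CoPH-reading lemma.  The N19′ ∕ N21 lanes' v8 re-issues
(`…N19RateEdgeHolderD4AtN16PinnedReading*`, `…N21RoadIAtN16LoosePinnedReading`) read, at the pinned reading, (a) the NE3 component's LETTERS (`R.ne3.L = F.L`, `.Nper`, `.ε`, `.b`,
`.g`, `.C`, `.Λ₁`, `.Λ₂'`, `.dom`), (b) the side letter at every radius `ε₁ ≥ (ℓ₃ F).ε ∕ B F`, (c) N16's conjunct per tuple as the β-root over the loose data, and (d) that the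
pin is not vacuous (the NE3-erased reading fails it).  All four are `rw [rateCarriersCmap_ne3_of_pinnedLoose …]` + module 44's object-level facts; stated here once, centre-map-generic
(every `Χ`; the Ax reading is the instance `Χ := chiβOfRecord₁₃Ax`, binder `θ.Provisos₁₃CoPHAx F N`).

HONEST FRAMING.  Kernel bookkeeping; no estimate; the pin is a HYPOTHESIS (a shape asserted for no reading); nothing of Bałaban asserted; no stub of K3ᴬ v8 closed or claimed;
N16 ∕ N19′ ∕ N21 NOT discharged; counts UNMOVED (typed 28∕28 · discharged 8∕27 · A 8∕28).  One finite four-torus at fixed `ε` — NOT ℝ⁴ ∕ infinite volume ∕ OS ∕ mass gap ∕ Clay.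
Reference: [Balaban1985Variational] T. Bałaban, CMP **102** (1985) 277–309, (7) p. 278, Thm 1 p. 279.
-/

set_option autoImplicit false

noncomputable section

open scoped BigOperators Matrix Matrix.Norms.L2Operator

namespace Summit.QuantumFields.YangMills.BalabanUVNodes.N16PinnedDataSmallFieldCmap

open Literature.MathematicalPhysics.QuantumFieldTheory.Balaban1983to89
open Literature.MathematicalPhysics.QuantumFieldTheory.Balaban1983to89.T4Continuum (T4Family ULoop)
open B7Prop1Explicit
open B7Prop2Explicit (C0)
open Node00 (Stage13Params Stage13HParams ChiSlot NE3Objects₁₁ NE3Letters₁₁ ne3ConstLayerOfRecord₁₁ ne3NperOfRecord₁₁ ne3DomOfRecord₁₁ MatA)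
open Summit.QuantumFields.BalabanUV.T4Continuum
open MinimalActionRate (sfClass)
open MinimalActionRefine (gradConst)
open YMDAG.UVSplit (NE3Carriers ne3OfRecord₁₁ RateReading₁₃CoPHCmap RateReading₁₃CoPHAx rateCarriersOfRecord₁₃CoPHCmap)
open Summit.QuantumFields.YangMills.BalabanUVNodes.N16HolderDefs (CovRootHolder N16HolderAt)
open Summit.QuantumFields.YangMills.BalabanUVNodes.N16PinnedLayer13CoPH (N16PinnedLooseCmap N16PinnedLooseAx rateCarriersCmap_ne3_of_pinnedLoose eraseNE3Cmap)
open Summit.QuantumFields.YangMills.BalabanUVNodes.N16PinnedDataSmallField (sfClass_zero_mono looseDom_nonempty)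

variable {N : ℕ} [NeZero N] {Χ : (F : T4Family) → Stage13Params F N → ChiSlot F N}

/-! ## §1 The NE3 component's letters at the bundle of record, under the loose pin -/

section Letters

variable {𝔯 : RateReading₁₃CoPHCmap N Χ} {ℓ₃ : T4Family → NE3Letters₁₁} {B : T4Family → ℝ} (h : N16PinnedLooseCmap 𝔯 ℓ₃ B)
  (F : T4Family) (θ : Stage13HParams F N) (hP : θ.Provisos₁₃CoPHChi F N (Χ F θ.toStage13Params)) (g₀ : ℕ → ℝ) (os : List (ULoop F)) (k : ℕ)
include h

/-- Under the loose pin: the lattice size letter is the family's `F.L`. [bookkeeping] -/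
theorem ne3_L_of_pinnedLooseCmap : (rateCarriersOfRecord₁₃CoPHCmap 𝔯 F θ hP g₀ os k).ne3.L = F.L := by
  rw [rateCarriersCmap_ne3_of_pinnedLoose h F θ hP g₀ os k]; rfl
/-- Under the loose pin: the period letter is `ne3NperOfRecord₁₁ F 0 0`. [bookkeeping] -/
theorem ne3_Nper_of_pinnedLooseCmap : (rateCarriersOfRecord₁₃CoPHCmap 𝔯 F θ hP g₀ os k).ne3.Nper = ne3NperOfRecord₁₁ F 0 0 := by
  rw [rateCarriersCmap_ne3_of_pinnedLoose h F θ hP g₀ os k]; rfl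
/-- Under the loose pin: the class radius is `(ℓ₃ F).ε`. [bookkeeping] -/
theorem ne3_ε_of_pinnedLooseCmap : (rateCarriersOfRecord₁₃CoPHCmap 𝔯 F θ hP g₀ os k).ne3.ε = (ℓ₃ F).ε := by
  rw [rateCarriersCmap_ne3_of_pinnedLoose h F θ hP g₀ os k]; rfl
/-- Under the loose pin: the regularity window is `(ℓ₃ F).b`. [bookkeeping] -/
theorem ne3_b_of_pinnedLooseCmap : (rateCarriersOfRecord₁₃CoPHCmap 𝔯 F θ hP g₀ os k).ne3.b = (ℓ₃ F).b := by
  rw [rateCarriersCmap_ne3_of_pinnedLoose h F θ hP g₀ os k]; rfl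
/-- Under the loose pin: the coupling letter is `(ℓ₃ F).g`. [bookkeeping] -/
theorem ne3_g_of_pinnedLooseCmap : (rateCarriersOfRecord₁₃CoPHCmap 𝔯 F θ hP g₀ os k).ne3.g = (ℓ₃ F).g := by
  rw [rateCarriersCmap_ne3_of_pinnedLoose h F θ hP g₀ os k]; rfl
/-- Under the loose pin: the energy constant is `(ℓ₃ F).C`. [bookkeeping] -/
theorem ne3_C_of_pinnedLooseCmap : (rateCarriersOfRecord₁₃CoPHCmap 𝔯 F θ hP g₀ os k).ne3.C = (ℓ₃ F).C := by
  rw [rateCarriersCmap_ne3_of_pinnedLoose h F θ hP g₀ os k]; rfl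
/-- Under the loose pin: the first Lipschitz constant is `(ℓ₃ F).Λ₁`. [bookkeeping] -/
theorem ne3_Λ₁_of_pinnedLooseCmap : (rateCarriersOfRecord₁₃CoPHCmap 𝔯 F θ hP g₀ os k).ne3.Λ₁ = (ℓ₃ F).Λ₁ := by
  rw [rateCarriersCmap_ne3_of_pinnedLoose h F θ hP g₀ os k]; rfl
/-- Under the loose pin: the Hölder constant is `(ℓ₃ F).Λ₂'`. [bookkeeping] -/
theorem ne3_Λ₂'_of_pinnedLooseCmap : (rateCarriersOfRecord₁₃CoPHCmap 𝔯 F θ hP g₀ os k).ne3.Λ₂' = (ℓ₃ F).Λ₂' := by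
  rw [rateCarriersCmap_ne3_of_pinnedLoose h F θ hP g₀ os k]; rfl
/-- Under the loose pin: the data are the LOOSE data of record (data of record CUT at radius `(ℓ₃ F).ε ∕ B F`). [cite: Balaban1985Variational, (7) p.278] [bookkeeping] -/
theorem ne3_dom_of_pinnedLooseCmap : (rateCarriersOfRecord₁₃CoPHCmap 𝔯 F θ hP g₀ os k).ne3.dom =
    {V | V ∈ ne3DomOfRecord₁₁ F N 0 0 ∧ V ∈ sfClass 4 F.L (ne3NperOfRecord₁₁ F 0 0) ((ℓ₃ F).ε / B F) 0} := by
  rw [rateCarriersCmap_ne3_of_pinnedLoose h F θ hP g₀ os k]; rfl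

/-- **NODE N16's CONJUNCT PER TUPLE IS THE β-ROOT OVER THE LOOSE DATA** (`N16HolderAt` unfolded at the pinned component; the N21 lane's `n16HolderAt_rateCarriers_iff_of_pinnedLoose`
at the centre-map-generic reading): tuple-free right-hand side. [bookkeeping] -/
theorem n16HolderAt_rateCarriersCmap_iff_of_pinnedLoose (β : ℝ) :
    N16HolderAt (rateCarriersOfRecord₁₃CoPHCmap 𝔯 F θ hP g₀ os k).ne3 β ↔
      CovRootHolder 4 (sfClass 4 F.L (ne3NperOfRecord₁₁ F 0 0) (ℓ₃ F).ε) F.L (ne3NperOfRecord₁₁ F 0 0) (ℓ₃ F).b (ℓ₃ F).g (ℓ₃ F).C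
        (ℓ₃ F).Λ₁ (ℓ₃ F).Λ₂' β
        {V | V ∈ ne3DomOfRecord₁₁ F N 0 0 ∧ V ∈ sfClass 4 F.L (ne3NperOfRecord₁₁ F 0 0) ((ℓ₃ F).ε / B F) 0} := by
  rw [rateCarriersCmap_ne3_of_pinnedLoose h F θ hP g₀ os k]; rfl

/-! ## §2 Node N19's side letter at every radius `ε₁ ≥ (ℓ₃ F).ε ∕ B F` -/

/-- **UNDER THE LOOSE PIN NODE N19's SIDE LETTER HOLDS AT EVERY RADIUS `ε₁ ≥ (ℓ₃ F).ε ∕ B F`** — module 44's `dom_subset_sfClass_of_pinnedLoose` at the centre-map-generic reading,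
pin BY NAME (`N16PinnedLooseCmap`): the loose data lie in print's (7)-ball by definition, `sfClass_zero_mono` does the rest. [cite: Balaban1985Variational, (7) p.278] [folklore] -/
theorem dom_subset_sfClass_of_pinnedLooseCmap {ε₁ : ℝ} (hε₁ : (ℓ₃ F).ε / B F ≤ ε₁) :
    (rateCarriersOfRecord₁₃CoPHCmap 𝔯 F θ hP g₀ os k).ne3.dom ⊆
      sfClass 4 (rateCarriersOfRecord₁₃CoPHCmap 𝔯 F θ hP g₀ os k).ne3.L (rateCarriersOfRecord₁₃CoPHCmap 𝔯 F θ hP g₀ os k).ne3.Nper ε₁ 0 := by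
  rw [rateCarriersCmap_ne3_of_pinnedLoose h F θ hP g₀ os k]
  exact fun V hV => sfClass_zero_mono hε₁ hV.2

/-- … in particular at node N19's datum radius `ε₁ := (ℓ₃ F).ε ∕ B F` itself. [bookkeeping] -/
theorem dom_subset_sfClass_datumRadius_of_pinnedLooseCmap :
    (rateCarriersOfRecord₁₃CoPHCmap 𝔯 F θ hP g₀ os k).ne3.dom ⊆
      sfClass 4 (rateCarriersOfRecord₁₃CoPHCmap 𝔯 F θ hP g₀ os k).ne3.L (rateCarriersOfRecord₁₃CoPHCmap 𝔯 F θ hP g₀ os k).ne3.Nper ((ℓ₃ F).ε / B F) 0 :=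
  dom_subset_sfClass_of_pinnedLooseCmap h F θ hP g₀ os k le_rfl

/-- **THE PINNED DATA ARE NON-EMPTY** whenever `0 ≤ (ℓ₃ F).ε` and `0 < B F` (the flat datum lies in the loose data, module 44 `looseDom_nonempty`). [bookkeeping] -/
theorem ne3_dom_nonempty_of_pinnedLooseCmap (hε : 0 ≤ (ℓ₃ F).ε) (hB : 0 < B F) :
    (rateCarriersOfRecord₁₃CoPHCmap 𝔯 F θ hP g₀ os k).ne3.dom.Nonempty := by
  rw [ne3_dom_of_pinnedLooseCmap h F θ hP g₀ os k]
  exact looseDom_nonempty (N := N) F (div_nonneg hε hB.le)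

end Letters

/-! ## §3 The pin is not vacuous: the NE3-erased reading fails it (given ONE tuple with χ-provisos) -/

/-- **A READING WHOSE NE3 DATA ARE EMPTY AT ONE TUPLE IS NOT PINNED LOOSE** (for `0 ≤ (ℓ₃ F).ε`, `0 < B F`) — module 44 §3's `not_pinnedLoose_of_ne3_dom_empty` at the
centre-map-generic reading, pin BY NAME. [bookkeeping] -/
theorem not_pinnedLooseCmap_of_ne3_dom_empty (𝔯 : RateReading₁₃CoPHCmap N Χ) (ℓ₃ : T4Family → NE3Letters₁₁) (B : T4Family → ℝ)
    {F : T4Family} (θ : Stage13HParams F N) (hP : θ.Provisos₁₃CoPHChi F N (Χ F θ.toStage13Params)) (g₀ : ℕ → ℝ) (os : List (ULoop F)) (k : ℕ)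
    (hempty : ((𝔯.lit F θ hP g₀ os).ne3 k).dom = ∅) (hε : 0 ≤ (ℓ₃ F).ε) (hB : 0 < B F) : ¬ N16PinnedLooseCmap 𝔯 ℓ₃ B := by
  intro hpin
  have hne := looseDom_nonempty (N := N) F (div_nonneg hε hB.le)
  have h : (∅ : Set ((Fin 4 → ℤ) → Fin 4 → (MatA N)ˣ)) =
      {V | V ∈ ne3DomOfRecord₁₁ F N 0 0 ∧ V ∈ sfClass 4 F.L (ne3NperOfRecord₁₁ F 0 0) ((ℓ₃ F).ε / B F) 0} := by
    rw [← hempty, hpin F θ hP g₀ os k]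
  rw [← h] at hne
  exact Set.not_nonempty_empty hne

/-- **… so the NE3-ERASED reading (R12's `eraseNE3Cmap 𝔯`, the vacuity witness of the N16 conjunct) FAILS THE LOOSE PIN** at any admissible dial, given ONE Stage-13 tuple with
χ-provisos (HYPOTHESIS — the record key's inhabitation is K0ᴬ's business). [bookkeeping] -/
theorem not_pinnedLooseCmap_eraseNE3 (𝔯 : RateReading₁₃CoPHCmap N Χ) (ℓ₃ : T4Family → NE3Letters₁₁) (B : T4Family → ℝ)
    {F : T4Family} (θ : Stage13HParams F N) (hP : θ.Provisos₁₃CoPHChi F N (Χ F θ.toStage13Params)) (hε : 0 ≤ (ℓ₃ F).ε) (hB : 0 < B F) :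
    ¬ N16PinnedLooseCmap (eraseNE3Cmap 𝔯) ℓ₃ B :=
  not_pinnedLooseCmap_of_ne3_dom_empty (eraseNE3Cmap 𝔯) ℓ₃ B θ hP (fun _ => 0) [] 0 rfl hε hB

/-! ## §4 (v1.1) Node N19's row readers at the pinned component — `…N16PinnedLooseMatch` §3 ∕ `…N16PinnedLooseMatchSqueeze(ClassRadius)` twins -/

section N19Rows

variable {𝔯 : RateReading₁₃CoPHCmap N Χ} {ℓ₃ : T4Family → NE3Letters₁₁} {B c' : T4Family → ℝ}

/-- **★ NODE N19's N16-SIDE LETTER UNDER THE LOOSE PIN WITH THE MATCH ROW** (the K3 skeletons' `N16RadiusMatch ℓ₃ B`, spelled): at every tuple and run length the datum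
radius `ε₁ := (ℓ₃ F).ε ∕ B F` satisfies `ε₁ ≤ R.ne3.b ∧ R.ne3.dom ⊆ sfClass 4 R.ne3.L R.ne3.Nper ε₁ 0` — `…N16PinnedLooseMatch.n19_domLetter_of_pinnedLoose_match` at the
centre-map-generic reading. [folklore] -/
theorem n19_domLetter_of_pinnedLooseCmap_match (hmatch : ∀ F : T4Family, 0 < B F ∧ (ℓ₃ F).ε / B F ≤ (ℓ₃ F).b) (hpin : N16PinnedLooseCmap 𝔯 ℓ₃ B)
    (F : T4Family) (θ : Stage13HParams F N) (hP : θ.Provisos₁₃CoPHChi F N (Χ F θ.toStage13Params)) (g₀ : ℕ → ℝ) (os : List (ULoop F)) (k : ℕ) :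
    (ℓ₃ F).ε / B F ≤ (rateCarriersOfRecord₁₃CoPHCmap 𝔯 F θ hP g₀ os k).ne3.b ∧
      (rateCarriersOfRecord₁₃CoPHCmap 𝔯 F θ hP g₀ os k).ne3.dom ⊆
        sfClass 4 (rateCarriersOfRecord₁₃CoPHCmap 𝔯 F θ hP g₀ os k).ne3.L (rateCarriersOfRecord₁₃CoPHCmap 𝔯 F θ hP g₀ os k).ne3.Nper ((ℓ₃ F).ε / B F) 0 := by
  refine ⟨?_, dom_subset_sfClass_of_pinnedLooseCmap hpin F θ hP g₀ os k le_rfl⟩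
  rw [ne3_b_of_pinnedLooseCmap hpin F θ hP g₀ os k]
  exact (hmatch F).2

/-- **NODE N19's RADII ROWS AT THE PINNED COMPONENT** — `…N16PinnedLooseMatchSqueeze.radiiRows_rateCarriers_of_pinnedLoose` at the centre-map-generic reading: the bill's
eight-row `hradii` block read at `R.ne3.g ∕ .b ∕ .L ∕ .ε`. [bookkeeping] -/
theorem radiiRows_rateCarriersCmap_of_pinnedLoose (hpin : N16PinnedLooseCmap 𝔯 ℓ₃ B)
    (hrows : ∀ F : T4Family, (ℓ₃ F).g = gradConst 4 (c' F) ∧ 0 ≤ c' F ∧ 0 < c' F ∧ (ℓ₃ F).b ≤ c' F ∧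
      (2 : ℝ) ^ 91 * (F.L : ℝ) ^ 17 * c' F ≤ 1 ∧ (2 : ℝ) ^ 76 * (F.L : ℝ) ^ 12 * c' F ≤ (ℓ₃ F).ε ∧
      (ℓ₃ F).ε / B F ≤ 1 / 4 ∧ 4 * ((ℓ₃ F).ε / B F) ≤ c' F)
    (F : T4Family) (θ : Stage13HParams F N) (hP : θ.Provisos₁₃CoPHChi F N (Χ F θ.toStage13Params)) (g₀ : ℕ → ℝ) (os : List (ULoop F)) (k : ℕ) :
    (rateCarriersOfRecord₁₃CoPHCmap 𝔯 F θ hP g₀ os k).ne3.g = gradConst 4 (c' F) ∧ 0 ≤ c' F ∧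
      (rateCarriersOfRecord₁₃CoPHCmap 𝔯 F θ hP g₀ os k).ne3.b ≤ c' F ∧ c' F ≤ c' F ∧
      (2 : ℝ) ^ 91 * ((rateCarriersOfRecord₁₃CoPHCmap 𝔯 F θ hP g₀ os k).ne3.L : ℝ) ^ 17 * c' F ≤ 1 ∧
      (2 : ℝ) ^ 76 * ((rateCarriersOfRecord₁₃CoPHCmap 𝔯 F θ hP g₀ os k).ne3.L : ℝ) ^ 12 * c' F ≤ (rateCarriersOfRecord₁₃CoPHCmap 𝔯 F θ hP g₀ os k).ne3.ε ∧
      4 * ((ℓ₃ F).ε / B F) ≤ c' F := by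
  rw [rateCarriersCmap_ne3_of_pinnedLoose hpin F θ hP g₀ os k]
  exact ⟨(hrows F).1, (hrows F).2.1, (hrows F).2.2.2.1, le_rfl, (hrows F).2.2.2.2.1, (hrows F).2.2.2.2.2.1, (hrows F).2.2.2.2.2.2.2⟩

/-- **NODE N19′'s TEN-ROW N16-LETTER BLOCK AT THE PINNED COMPONENT** — `…N16PinnedLooseMatchSqueezeClassRadius.n16LetterBlock_rateCarriers_of_pinnedLoose` at the
centre-map-generic reading (module 50's block with the two class-radius rows `16·C0·ε ≤ 3`, `1024·(4+1)·(4+4)·L²·ε ≤ 1`). [bookkeeping] -/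
theorem n16LetterBlock_rateCarriersCmap_of_pinnedLoose (hpin : N16PinnedLooseCmap 𝔯 ℓ₃ B)
    (hrows : ∀ F : T4Family, (ℓ₃ F).g = gradConst 4 (c' F) ∧ 0 ≤ c' F ∧ 0 < c' F ∧ (ℓ₃ F).b ≤ c' F ∧
      (2 : ℝ) ^ 91 * (F.L : ℝ) ^ 17 * c' F ≤ 1 ∧ (2 : ℝ) ^ 76 * (F.L : ℝ) ^ 12 * c' F ≤ (ℓ₃ F).ε ∧
      16 * C0 4 * (ℓ₃ F).ε ≤ 3 ∧ 1024 * (4 + 1) * (4 + 4) * (F.L : ℝ) ^ 2 * (ℓ₃ F).ε ≤ 1 ∧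
      (ℓ₃ F).ε / B F ≤ 1 / 4 ∧ 4 * ((ℓ₃ F).ε / B F) ≤ c' F)
    (F : T4Family) (θ : Stage13HParams F N) (hP : θ.Provisos₁₃CoPHChi F N (Χ F θ.toStage13Params)) (g₀ : ℕ → ℝ) (os : List (ULoop F)) (k : ℕ) :
    (rateCarriersOfRecord₁₃CoPHCmap 𝔯 F θ hP g₀ os k).ne3.g = gradConst 4 (c' F) ∧ 0 ≤ c' F ∧
      (rateCarriersOfRecord₁₃CoPHCmap 𝔯 F θ hP g₀ os k).ne3.b ≤ c' F ∧ c' F ≤ c' F ∧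
      (2 : ℝ) ^ 91 * ((rateCarriersOfRecord₁₃CoPHCmap 𝔯 F θ hP g₀ os k).ne3.L : ℝ) ^ 17 * c' F ≤ 1 ∧
      (2 : ℝ) ^ 76 * ((rateCarriersOfRecord₁₃CoPHCmap 𝔯 F θ hP g₀ os k).ne3.L : ℝ) ^ 12 * c' F ≤ (rateCarriersOfRecord₁₃CoPHCmap 𝔯 F θ hP g₀ os k).ne3.ε ∧
      16 * C0 4 * (rateCarriersOfRecord₁₃CoPHCmap 𝔯 F θ hP g₀ os k).ne3.ε ≤ 3 ∧
      1024 * (4 + 1) * (4 + 4) * ((rateCarriersOfRecord₁₃CoPHCmap 𝔯 F θ hP g₀ os k).ne3.L : ℝ) ^ 2 * (rateCarriersOfRecord₁₃CoPHCmap 𝔯 F θ hP g₀ os k).ne3.ε ≤ 1 ∧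
      4 * ((ℓ₃ F).ε / B F) ≤ c' F := by
  rw [rateCarriersCmap_ne3_of_pinnedLoose hpin F θ hP g₀ os k]
  exact ⟨(hrows F).1, (hrows F).2.1, (hrows F).2.2.2.1, le_rfl, (hrows F).2.2.2.2.1, (hrows F).2.2.2.2.2.1, (hrows F).2.2.2.2.2.2.1,
    (hrows F).2.2.2.2.2.2.2.1, (hrows F).2.2.2.2.2.2.2.2.2⟩

end N19Rows

end Summit.QuantumFields.YangMills.BalabanUVNodes.N16PinnedDataSmallFieldCmap

end
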